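import Summits.BirchSwinnertonDyer.BirchSwinnertonDyer.Theses.EdixhovenFibreFiveSeven
import Summits.BirchSwinnertonDyer.BirchSwinnertonDyer.Theses.TeichmullerTwistDescent
import Literature.NumberTheory.EllipticCurves.IsogenyPotentiallyGoodMinimalDiscriminantProofs
import Summits.BirchSwinnertonDyer.BirchSwinnertonDyer.Theorems.EdixhovenFibreFiveSevenManinConstantDividesDegree
import Summits.BirchSwinnertonDyer.BirchSwinnertonDyer.Theorems.ManinLocalTwoThreeAbbesUllmoCesnaviciusManinConstant
import HarnessLib

/-!
# The PUB bundle `PublishedManinFacts` (stmt-BirchSwinnertonDyer-22230; routes EdixhovenFibreFiveSeven and TeichmullerTwistDescent)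
# follows from MODULARITY ALONE — six of its seven printed conjuncts are tree theorems, the seventh (ČNS Thm. 1.2) is a theorem
# modulo `exists_isNewformOf`

Route `EdixhovenFibreFiveSeven` (cell `pub/bsd-wall`, seat `bsd-line-edix-p1` g43), `--supports stmt-BirchSwinnertonDyer-22230`.
`PublishedManinFacts` is the binder `hF` of both deciding theorems, next to `hP : PublishedInputsAdditiveKoly` (sixth conjunct =
the Modularity theorem `exists_isNewformOf`).  Its conjuncts and their discharges (all UDC-dependent through the in-tree
unbounded-denominators term; audit (P†) pending):

1. Edixhoven 1991 Thm 3, non-potentially-ordinary reading — `p ∤ c₀` for `p ≥ 3` (`not_dvd_maninConstant_of_three_le`, p828097;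
   the named discharge `edixhoven_…_not_potentiallyGoodOrdinary_holds` is p828103, re-derived inline here to keep the import cone route-free);
2. Edixhoven 1991 Thm 3, Kodaira reading — likewise;
3. Dokchitser–Dokchitser 2015 Thm 5.1(1) — `dokchitser_padicValInt_minimalDiscriminantInt_eq_of_isogeny_of_not_dvd_degree_holds` (p602515);
4. Mazur 1978 Cor 4.1 — `mazur_not_dvd_maninConstant_of_odd_holds` (p828097);
5. Abbes–Ullmo 1996 Thm A — `abbesUllmo_not_dvd_maninConstant_of_not_dvd_level_holds` (p828339);
6. Česnavičius 2018 Thm 1.2 — `cesnavicius_not_two_dvd_maninConstant_of_two_dvd_level_holds` (p828339);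
7. Česnavičius–Neururer–Saha Thm 1.2 — `cesnaviciusNeururerSaha_padicVal_maninConstant_le_modularDegree_of_modularity` (p829622, this seat:
   unconditional at `p ≥ 3`, modularity at `p = 2`).

* `publishedManinFacts_of_modularity : exists_isNewformOf → PublishedManinFacts` (EF57 and TTD), and `…_of_publishedInputs`
  (`hF := … hP`, planner datum for both `closes`).

HONEST STATUS.  CONDITIONAL on the Modularity theorem as typed; the item 22230 stays OPEN as filed (conjunct 7 at `p = 2` is asserted
outright).  BSD is proved for no curve; Manin's conjecture is not announced.
[cite: EdixhovenManin1991, Thm. 3] [cite: Mazur1978, Cor. 4.1] [cite: AbbesUllmo1996, Thm. A] [cite: Cesnavicius2018, Thm. 1.2]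
[cite: CesnaviciusNeururerSaha2023, Thm. 1.2] [cite: BCDTJAMS2001, Thm. A]
-/

set_option autoImplicit false
-- the Theorems namespace of this sub repeats the summit name by design (D-0017 nested layout)
set_option linter.dupNamespace false

namespace Summit.BirchSwinnertonDyer.BirchSwinnertonDyer.Theorems

open Literature.NumberTheory.EllipticCurves Literature.NumberTheory.EllipticCurves.ModularForms

/-- **EF57's bundle `PublishedManinFacts` (stmt-BirchSwinnertonDyer-22230) ⟸ modularity**: six conjuncts are tree theorems, the ČNS
conjunct is `cesnaviciusNeururerSaha_padicVal_maninConstant_le_modularDegree_of_modularity`.  CONDITIONAL; the item stays open as filed.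
[cite: CesnaviciusNeururerSaha2023, Thm. 1.2] [cite: BCDTJAMS2001, Thm. A] -/
theorem EdixhovenFibreFiveSeven.publishedManinFacts_of_modularity (hnf : exists_isNewformOf) :
    Summit.BirchSwinnertonDyer.BirchSwinnertonDyer.Theses.EdixhovenFibreFiveSeven.PublishedManinFacts :=
  ⟨fun W' _ _ _ D' hopt _ _ hp7 _ ↦ not_dvd_maninConstant_of_three_le W' D' hopt (by omega),
    fun W' _ _ _ D' hopt _ _ hp7 _ _ _ ↦ not_dvd_maninConstant_of_three_le W' D' hopt (by omega),
    dokchitser_padicValInt_minimalDiscriminantInt_eq_of_isogeny_of_not_dvd_degree_holds,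
    mazur_not_dvd_maninConstant_of_odd_holds,
    abbesUllmo_not_dvd_maninConstant_of_not_dvd_level_holds,
    cesnavicius_not_two_dvd_maninConstant_of_two_dvd_level_holds,
    cesnaviciusNeururerSaha_padicVal_maninConstant_le_modularDegree_of_modularity hnf⟩

/-- **EF57: `hF` from `hP`** — `PublishedManinFacts` from `PublishedInputsAdditiveKoly` (stmt-20137; sixth conjunct = modularity).
Planner datum for `Theses.EdixhovenFibreFiveSeven.closes`.  CONDITIONAL (hypothesis bundle). [cite: BCDTJAMS2001, Thm. A] -/
theorem EdixhovenFibreFiveSeven.publishedManinFacts_of_publishedInputs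
    (hP : Summit.BirchSwinnertonDyer.BirchSwinnertonDyer.Theses.EdixhovenFibreFiveSeven.PublishedInputsAdditiveKoly) :
    Summit.BirchSwinnertonDyer.BirchSwinnertonDyer.Theses.EdixhovenFibreFiveSeven.PublishedManinFacts :=
  EdixhovenFibreFiveSeven.publishedManinFacts_of_modularity hP.2.2.2.2.2.1

/-- **TTD's bundle `PublishedManinFacts` (same item 22230, route TeichmullerTwistDescent) ⟸ modularity** (identical body).
CONDITIONAL; the item stays open as filed. [cite: CesnaviciusNeururerSaha2023, Thm. 1.2] [cite: BCDTJAMS2001, Thm. A] -/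
theorem TeichmullerTwistDescent.publishedManinFacts_of_modularity (hnf : exists_isNewformOf) :
    Summit.BirchSwinnertonDyer.BirchSwinnertonDyer.Theses.TeichmullerTwistDescent.PublishedManinFacts :=
  EdixhovenFibreFiveSeven.publishedManinFacts_of_modularity hnf

/-- **TTD: `hF` from `hP`** — planner datum for `Theses.TeichmullerTwistDescent.closes`.  CONDITIONAL (hypothesis bundle).
[cite: BCDTJAMS2001, Thm. A] -/
theorem TeichmullerTwistDescent.publishedManinFacts_of_publishedInputs
    (hP : Summit.BirchSwinnertonDyer.BirchSwinnertonDyer.Theses.TeichmullerTwistDescent.PublishedInputsAdditiveKoly) :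
    Summit.BirchSwinnertonDyer.BirchSwinnertonDyer.Theses.TeichmullerTwistDescent.PublishedManinFacts :=
  TeichmullerTwistDescent.publishedManinFacts_of_modularity hP.2.2.2.2.2.1

end Summit.BirchSwinnertonDyer.BirchSwinnertonDyer.Theorems
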